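import Summits.Parity.GeneralizedHardyLittlewood.Theses.LeeYangFibres
import Summits.Parity.GeneralizedHardyLittlewood.Theorems.LeeYangFibresCellParityLawConditional
import Summits.Parity.GeneralizedHardyLittlewood.Theorems.LeeYangFibresCellParityLawRelDefs
import Summits.Parity.GeneralizedHardyLittlewood.Theorems.LeeYangFibresCellParityLawRelConsumer
import Summits.Parity.GeneralizedHardyLittlewood.Theorems.LeeYangFibresCellParityLawP2Defs
import Summits.Parity.GeneralizedHardyLittlewood.Theorems.LeeYangFibresCellParityLawPrimeUpperBound
import Summits.Parity.GeneralizedHardyLittlewood.Theorems.LeeYangFibresCellParityLawRecursionIdentity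
import Summits.Parity.GeneralizedHardyLittlewood.Theorems.LeeYangFibresCellParityLawFibreInheritance
import Summits.Parity.GeneralizedHardyLittlewood.Theorems.LeeYangFibresCellParityLawModelPrimeSum
import Summits.Parity.GeneralizedHardyLittlewood.Theorems.LeeYangFibresCellParityLawCoveringInequality
import Summits.Parity.GeneralizedHardyLittlewood.Theorems.LeeYangFibresCellParityLawGeThreeReduceStrong
import Summits.Parity.GeneralizedHardyLittlewood.Theorems.LeeYangFibresCellParityLawKernelInductionAux
import Summits.Parity.GeneralizedHardyLittlewood.Theorems.LeeYangFibresCellParityLawKernelInductionFibres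
import Summits.Parity.GeneralizedHardyLittlewood.Theorems.LeeYangFibresCellParityLawKernelInductionSums
import Summits.Parity.GeneralizedHardyLittlewood.Theorems.LeeYangFibresCellParityLawKernelInductionStep
import Summits.Parity.GeneralizedHardyLittlewood.Theorems.LeeYangFibresCellParityLawInductionDefs
import Summits.Parity.GeneralizedHardyLittlewood.Theorems.LeeYangFibresCellParityLawInductionBaseOne
import Summits.Parity.GeneralizedHardyLittlewood.Theorems.LeeYangFibresCellParityLawInductionBaseTwo
import Summits.Parity.GeneralizedHardyLittlewood.Theorems.LeeYangFibresCellParityLawInductionPackage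
import Summits.Parity.GeneralizedHardyLittlewood.Theorems.LeeYangFibresCellParityLawInductionStep

/-!
# Line `section-annihilator` — skeleton v20 for crux `LeeYangFibres.CellParityLaw` (stmt-Parity-14109)

Continuation lead `prover-line-stmt-Parity-14109-c6-0` (2026-08-16). v19 = v18b (lead c5) with every stub that has
LANDED since imported by name instead of re-stated: `stub_primeUpperBound` (p123084), `stub_recursionIdentity`
(p122589), `stub_fibreInheritance` (p124156), `stub_modelPrimeSum` (p125471), `stub_coveringInequality` (p125802),
`stub_geThreeReduceStrong` (p126342); the tools of the induction landed by c5 are imported too (error currency /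
vanishing p126623, fibre data p126643, fibre error sums p127019, pointwise fibre step p127018).

Open registered stubs (the only `sorry`s): `stub_sectionLevel` (ATOM, conjecture by design — typed tuple-GEH for the
section sequences) and `stub_weightedP2Law` (KERNEL, research — Bombieri's `P₂` law for the Buchstab test functions, effective
with polynomial rate in the level deficit, uniform over the admissible class). `KernelInduction` is CLOSED (lead c6): vocabulary
`Theorems/LeeYangFibresCellParityLawInductionDefs.lean` (p127248: induction predicate `CellLawAt m` with the explicit clipped
parameter `cellDelta`), pieces `stub_inductionBaseOne` (p127406), `stub_inductionBaseTwo` (p127443), `stub_inductionPackage`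
(p127444), `stub_inductionStep` (sub-goals `stub_fibreRanges` p127676, `stub_sumRestrict` p127642, `stub_stepBudget` p127795),
composed by the landed bookkeeping `stub_kernelInductionPieces`. Composition: `CellParityLaw_of` BY NAME, no `Prop` hypotheses.

Structure (unchanged from v18, see `Theorems/LeeYangFibresCellParityLawP2Defs.lean`): the exact Buchstab recursion
`C_{m+1}(𝒜; x, z) = Σ_{z<p} C_m(𝒜_p; x/p, p⁻)` plus inheritance of kernel-admissibility by the fibres reduces the
`m`-cell law to the fibres' `(m−1)`-cell laws (each with its own parity parameter pinned by the fibre's prime count)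
plus ONE coherence statement, the effective weighted `P₂` law; the linear-sieve upper bound clips `δ = 2 − C₁/T` into
`[0, 2]`; the model prime sum telescopes to `I_{m+1}(u') T`.
-/

noncomputable section

open scoped BigOperators Classical
open Finset Filter Literature.NumberTheory.Sieve

namespace Summit.Parity.GeneralizedHardyLittlewood.Cruxes.CellParityLaw.SectionAnnihilator

/-! ## Registered stubs -/

/-- ATOM (open; the line's single conjectural input, unchanged since v1): the tuple-GEH fragment, typed. -/
theorem stub_sectionLevel : ∀ t : ℕ, 1 ≤ t → SectionLevelAt t := by
  sorry

/-- KERNEL (open; research statement, crux-independent; held by the lead): the effective weighted `P₂` law. -/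
theorem stub_weightedP2Law : EffectiveWeightedP2Law := by
  sorry

/-- The induction along the Buchstab recursion, composed from its four registered pieces through the landed
bookkeeping `stub_kernelInductionPieces` (InductionDefs p127248). -/
theorem stub_kernelInduction : KernelInduction :=
  stub_kernelInductionPieces stub_inductionBaseOne stub_inductionBaseTwo stub_inductionStep stub_inductionPackage

/-! ## Composition (kernel-checked; every other piece is a landed theorem) -/

/-- The strong rough-cell kernel from the reshaped inputs (`KernelInduction`). -/
theorem kernelStrong_of : EffectiveRoughCellLawStrong :=
  stub_kernelInduction stub_primeUpperBound stub_recursionIdentity stub_fibreInheritance stub_modelPrimeSum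
    stub_weightedP2Law

/-- The `u ≥ 3` rung of Bombieri's `P_r` law for the sections through the strong kernel and the landed glue. -/
theorem sectionPrLawGeThree_strong :
    ∀ t : ℕ, 1 ≤ t → SectionLevelAt t → ∀ u : ℕ, 3 ≤ u → SectionPrLawAtU u t :=
  stub_geThreeComposeStrong stub_primeUpperBound stub_recursionIdentity stub_fibreInheritance stub_modelPrimeSum
    stub_weightedP2Law stub_kernelInduction stub_coveringInequality
    stub_sectionSeqBFacts stub_sectionSeqBCells stub_sectionDimension stub_sectionDimensionLow
    stub_sectionMertensLowerHead stub_sectionMertensTwo stub_modelDensityAlladi stub_prLawTwoPrep stub_eulerRatio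
    stub_geThreeHyp stub_geThreeReduceStrong stub_geThreeMainTerm stub_geThreeAssembly

/-- The engine at every roughness `u ≥ 2` (case split of the landed `u = 2` rung and the strong `u ≥ 3` rung,
Euler-ratio identity, conversion and bookkeeping — all landed). -/
theorem sectionLaw_strong : ∀ t : ℕ, 1 ≤ t → SectionLevelAt t → SectionLawAt t :=
  stub_engineCompose stub_eulerRatio (stub_prLawCases sectionPrLawTwo_of_atom sectionPrLawGeThree_strong)
    stub_lawOfPrLaw

/-- The line concludes the crux BY NAME: the landed reduction applied to the atom and the engine built from
the reshaped kernel. No `Prop` hypotheses. -/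
theorem CellParityLaw_of :
    Summit.Parity.GeneralizedHardyLittlewood.Theses.LeeYangFibres.CellParityLaw :=
  cellParityLaw_of_atom_of_engine stub_sectionLevel sectionLaw_strong

/-- Downstream bookkeeping: the relative form of the crux along this line. -/
theorem CellParityLawRel_of : CellParityLawRel :=
  stub_relOfAbs CellParityLaw_of

end Summit.Parity.GeneralizedHardyLittlewood.Cruxes.CellParityLaw.SectionAnnihilator

end
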